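import Summits.HubbardSuperconductivity.HubbardSuperconductivity.Theorems.ThermalWedgeTwSeededEnsembleEquivalenceRFreeAnomalousMargin
import Summits.HubbardSuperconductivity.HubbardSuperconductivity.Theorems.ThermalWedgeTwSeededEnsembleEquivalenceRWardReduction

/-!
# Reduction theorems: DEEP-SIGN and `TwSeededEnsembleEquivalenceR` from an `O(a)` ANOMALOUS REMAINDER
# (crux stmt-HubbardSuperconductivity-15581, line `Sketch`, skeleton v10; pool seat 0)

Support file (`--supports stmt-HubbardSuperconductivity-15581`; sorry-free; no definition; route-file free apart from
the crux decl via `…RWardReduction`).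

Skeleton v10 (lead c11) leaves ONE physics stub, DEEP-SIGN (`stub_fvDeepAnomalousSign`): at the cold slice
`β = e^{a/U}` and deep sources `h ∈ (e^{−a/(4U)}, 13g+1)`, eventually in `L`,
`A_L(U) := Re(Δ_d,Δ_d)_{Duh} − (Re⟨Δ_d⟩)² ≤ 0` for `H = dWaveSourceTorus L U μ h`. With the FREE ANOMALOUS MARGIN
(`fam_freeAnomalousMargin`: `A_L(0) ≤ −c·L²/β` on the same range, `c = c(μ₁) > 0`, uniformly in `L`, `β`, `h`)
the stub splits as SIGNAL + REMAINDER, and only the remainder is physics: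

  (REM)  for every window there is `C ≥ 0` such that for all `a ∈ (0,1]` there are `K', U₀ > 0` with: for
         `U ∈ (0,U₀]`, `g ∈ [K'U, 1/10]`, `μ ∈ (μ₁,μ₂)`, eventually in `L`, for `h ∈ (e^{−a/(4U)}, 13g+1)`,
         `A_L(U; e^{a/U}, μ, h) − A_L(0; e^{a/U}, μ, h) ≤ C · a · L² / e^{a/U}`

— the interacting truncated anomalous pair correlator exceeds the free one by at most `O(a)·L²/β` (the natural
output of a sourced weak-coupling expansion in which every order carries `U·log(1/h) ≤ a/4`; `C` must not depend
on `a`). Proved here: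

* `fam_fvDeepAnomalousSign_of_remainder` : (REM) ⟹ DEEP-SIGN verbatim (`a₁ = min 1 (c/(C+1))`, `U₀ ↦ min U₀ (a/4)` so
  that `βh ≥ e^{3a/(4U)} ≥ e³ > 4π`, `L₀ = max`);
* `twR_of_condensation_of_anomalousRemainder` : `TwSourcedCondensation` → (REM) → `TwSeededEnsembleEquivalenceR`
  (composition with `twR_of_condensation_of_fvDeepAnomalousSign`, …RWardReduction).

So the crux's physics input may be taken in REMAINDER form: a one-sided `O(a)` comparison of ONE finite-volume
truncated two-point function of the interacting sourced torus with its explicitly known free value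
(`fam_freeAnomalousMargin_eq`). [folklore: signal + remainder]
-/

set_option linter.dupNamespace false

noncomputable section

namespace Summit.HubbardSuperconductivity.HubbardSuperconductivity.Theorems

open Real Set Matrix Finset Literature.MathematicalPhysics.QuantumLattice Literature.Probability.LatticeModels
open Summit.HubbardSuperconductivity.HubbardSuperconductivity.Theses.ThermalWedge
open Summit.HubbardSuperconductivity.HubbardSuperconductivity.Theorems.TwSeededEnsembleEquivalenceR
open scoped ComplexOrder

/-- `4π < e³` (`π ≤ 4`, `e > 2.718`). [folklore] -/
theorem fam_four_pi_lt_exp_three : 4 * π < Real.exp 3 := by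
  have h1 : Real.exp 3 = Real.exp 1 ^ 3 := by rw [← Real.exp_nat_mul]; norm_num
  have h2 := Real.exp_one_gt_d9
  have h3 := Real.pi_le_four
  have h4 : (2.7182818283 : ℝ) ^ 3 < Real.exp 1 ^ 3 := pow_lt_pow_left₀ h2 (by norm_num) (by norm_num)
  have h5 : (16 : ℝ) < Real.exp 1 ^ 3 := lt_trans (by norm_num) h4
  rw [h1]
  linarith

/-- **DEEP-SIGN from an `O(a)` anomalous remainder.** If for every window `-4 < μ₁ < μ₂ < 0` there is `C ≥ 0`
such that for all `a ∈ (0, 1]` there are `K', U₀ > 0` with: for `U ∈ (0, U₀]`, `g ∈ [K'U, 1/10]`, `μ ∈ (μ₁, μ₂)`,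
eventually in `L`, for all `h ∈ (e^{−a/(4U)}, 13g+1)`,
`[Re(Δ,Δ)_{Duh} − (Re⟨Δ⟩)²](U) − [Re(Δ,Δ)_{Duh} − (Re⟨Δ⟩)²](0) ≤ C·a·L²/e^{a/U}` at `β = e^{a/U}`, then the registered
physics stub `stub_fvDeepAnomalousSign` holds (the free term is `≤ −c·L²/β` by `fam_freeAnomalousMargin`, and
`C·a ≤ c` for `a ≤ c/(C+1)`). [folklore] -/
theorem fam_fvDeepAnomalousSign_of_remainder :
    (∀ (μ₁ μ₂ : ℝ), -4 < μ₁ → μ₁ < μ₂ → μ₂ < 0 → ∃ C : ℝ, 0 ≤ C ∧ ∀ a ∈ Set.Ioc (0 : ℝ) 1,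
      ∃ K' U₀ : ℝ, 0 < K' ∧ 0 < U₀ ∧ ∀ U ∈ Set.Ioc (0 : ℝ) U₀, ∀ g ∈ Set.Icc (K' * U) (1 / 10),
        ∀ μ ∈ Set.Ioo μ₁ μ₂, ∃ L₀ : ℕ, ∀ (L : ℕ) [NeZero L], L₀ ≤ L →
          ∀ h ∈ Set.Ioo (Real.exp (-(a / (4 * U)))) (13 * g + 1),
            ((Matrix.duhamel (Real.exp (a / U)) (Literature.MathematicalPhysics.QuantumLattice.dWaveSourceTorus L U μ h)
                (Literature.MathematicalPhysics.QuantumLattice.pairField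
                  Literature.MathematicalPhysics.QuantumLattice.dWaveFormFactor L)
                (Literature.MathematicalPhysics.QuantumLattice.pairField
                  Literature.MathematicalPhysics.QuantumLattice.dWaveFormFactor L)).re -
              (Matrix.gibbsState (Real.exp (a / U)) (Literature.MathematicalPhysics.QuantumLattice.dWaveSourceTorus L U μ h)
                (Literature.MathematicalPhysics.QuantumLattice.pairField
                  Literature.MathematicalPhysics.QuantumLattice.dWaveFormFactor L)).re ^ 2) -
            ((Matrix.duhamel (Real.exp (a / U)) (Literature.MathematicalPhysics.QuantumLattice.dWaveSourceTorus L 0 μ h)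
                (Literature.MathematicalPhysics.QuantumLattice.pairField
                  Literature.MathematicalPhysics.QuantumLattice.dWaveFormFactor L)
                (Literature.MathematicalPhysics.QuantumLattice.pairField
                  Literature.MathematicalPhysics.QuantumLattice.dWaveFormFactor L)).re -
              (Matrix.gibbsState (Real.exp (a / U)) (Literature.MathematicalPhysics.QuantumLattice.dWaveSourceTorus L 0 μ h)
                (Literature.MathematicalPhysics.QuantumLattice.pairField
                  Literature.MathematicalPhysics.QuantumLattice.dWaveFormFactor L)).re ^ 2) ≤
            C * a * (L : ℝ) ^ 2 / Real.exp (a / U)) →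
    ∀ (μ₁ μ₂ : ℝ), -4 < μ₁ → μ₁ < μ₂ → μ₂ < 0 → ∃ a₁ : ℝ, 0 < a₁ ∧ ∀ a ∈ Set.Ioc (0 : ℝ) a₁,
      ∃ K' U₀ : ℝ, 0 < K' ∧ 0 < U₀ ∧ ∀ U ∈ Set.Ioc (0 : ℝ) U₀, ∀ g ∈ Set.Icc (K' * U) (1 / 10),
        ∀ μ ∈ Set.Ioo μ₁ μ₂, ∃ L₀ : ℕ, ∀ (L : ℕ) [NeZero L], L₀ ≤ L →
          ∀ h ∈ Set.Ioo (Real.exp (-(a / (4 * U)))) (13 * g + 1),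
            (Matrix.duhamel (Real.exp (a / U)) (Literature.MathematicalPhysics.QuantumLattice.dWaveSourceTorus L U μ h)
                (Literature.MathematicalPhysics.QuantumLattice.pairField
                  Literature.MathematicalPhysics.QuantumLattice.dWaveFormFactor L)
                (Literature.MathematicalPhysics.QuantumLattice.pairField
                  Literature.MathematicalPhysics.QuantumLattice.dWaveFormFactor L)).re ≤
              (Matrix.gibbsState (Real.exp (a / U)) (Literature.MathematicalPhysics.QuantumLattice.dWaveSourceTorus L U μ h)
                (Literature.MathematicalPhysics.QuantumLattice.pairField
                  Literature.MathematicalPhysics.QuantumLattice.dWaveFormFactor L)).re ^ 2 := by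
  intro hREM μ₁ μ₂ hμ₁ hμ₁₂ hμ₂
  obtain ⟨c, hc, hFM⟩ := fam_freeAnomalousMargin μ₁ μ₂ hμ₁ hμ₁₂ hμ₂
  obtain ⟨C, hC, hR⟩ := hREM μ₁ μ₂ hμ₁ hμ₁₂ hμ₂
  have hcC : 0 < c / (C + 1) := div_pos hc (by linarith)
  refine ⟨min 1 (c / (C + 1)), lt_min one_pos hcC, ?_⟩
  intro a ha
  have ha0 : 0 < a := ha.1
  have ha1 : a ∈ Set.Ioc (0 : ℝ) 1 := ⟨ha.1, ha.2.trans (min_le_left _ _)⟩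
  have haC : a ≤ c / (C + 1) := ha.2.trans (min_le_right _ _)
  have hCa : C * a ≤ c := by
    have h1 : (C + 1) * a ≤ c := by rwa [← le_div_iff₀' (by linarith)]
    nlinarith
  obtain ⟨K', U₀, hK', hU₀, hR'⟩ := hR a ha1
  refine ⟨K', min U₀ (a / 4), hK', lt_min hU₀ (by linarith), ?_⟩
  intro U hU g hg μ hμ
  have hU0 : 0 < U := hU.1
  have hU' : U ∈ Set.Ioc (0 : ℝ) U₀ := ⟨hU.1, hU.2.trans (min_le_left _ _)⟩
  have hUa : U ≤ a / 4 := hU.2.trans (min_le_right _ _)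
  obtain ⟨L₁, hL₁⟩ := hR' U hU' g hg μ hμ
  obtain ⟨L₂, hL₂⟩ := hFM (Real.exp (-(a / (4 * U)))) (Real.exp_pos _)
  refine ⟨max L₁ L₂, ?_⟩
  intro L _ hL h hh
  set β : ℝ := Real.exp (a / U) with hβ_def
  have hβ : 0 < β := Real.exp_pos _
  -- the free margin applies: `μ ∈ [μ₁,μ₂]`, `h ∈ [e^{-a/(4U)}, 3]`, `βh ≥ e^{3a/(4U)} ≥ e³ > 4π`
  have hμ' : μ ∈ Set.Icc μ₁ μ₂ := ⟨hμ.1.le, hμ.2.le⟩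
  have hh' : h ∈ Set.Icc (Real.exp (-(a / (4 * U)))) 3 := ⟨hh.1.le, by linarith [hh.2, hg.2]⟩
  have hβh : 4 * π ≤ β * h := by
    have h1 : Real.exp 3 ≤ β * Real.exp (-(a / (4 * U))) := by
      rw [hβ_def, ← Real.exp_add, Real.exp_le_exp]
      have h2 : a / U - a / (4 * U) = 3 * (a / (4 * U)) := by field_simp; ring
      have h3 : 1 ≤ a / (4 * U) := by rw [le_div_iff₀ (by positivity)]; linarith
      linarith
    have h2 : β * Real.exp (-(a / (4 * U))) ≤ β * h := mul_le_mul_of_nonneg_left hh.1.le hβ.le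
    linarith [fam_four_pi_lt_exp_three]
  have hF := hL₂ L (le_of_max_le_right hL) β hβ μ hμ' h hh' hβh
  have hRR := hL₁ L (le_of_max_le_left hL) h hh
  have hL' : (0 : ℝ) ≤ (L : ℝ) ^ 2 := by positivity
  have hkey : (C * a - c) * (L : ℝ) ^ 2 / β ≤ 0 :=
    div_nonpos_of_nonpos_of_nonneg (mul_nonpos_of_nonpos_of_nonneg (by linarith) hL') hβ.le
  have e1 : (C * a - c) * (L : ℝ) ^ 2 / β = C * a * (L : ℝ) ^ 2 / β - c * (L : ℝ) ^ 2 / β := by ring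
  rw [e1] at hkey
  linarith

/-- **`TwSeededEnsembleEquivalenceR` from `TwSourcedCondensation` and an `O(a)` anomalous remainder**: the
crux's physics input in REMAINDER form (composition of `fam_fvDeepAnomalousSign_of_remainder` with the landed Ward
reduction `twR_of_condensation_of_fvDeepAnomalousSign`). [folklore] -/
theorem twR_of_condensation_of_anomalousRemainder :
    TwSourcedCondensation →
    (∀ (μ₁ μ₂ : ℝ), -4 < μ₁ → μ₁ < μ₂ → μ₂ < 0 → ∃ C : ℝ, 0 ≤ C ∧ ∀ a ∈ Set.Ioc (0 : ℝ) 1,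
      ∃ K' U₀ : ℝ, 0 < K' ∧ 0 < U₀ ∧ ∀ U ∈ Set.Ioc (0 : ℝ) U₀, ∀ g ∈ Set.Icc (K' * U) (1 / 10),
        ∀ μ ∈ Set.Ioo μ₁ μ₂, ∃ L₀ : ℕ, ∀ (L : ℕ) [NeZero L], L₀ ≤ L →
          ∀ h ∈ Set.Ioo (Real.exp (-(a / (4 * U)))) (13 * g + 1),
            ((Matrix.duhamel (Real.exp (a / U)) (Literature.MathematicalPhysics.QuantumLattice.dWaveSourceTorus L U μ h)
                (Literature.MathematicalPhysics.QuantumLattice.pairField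
                  Literature.MathematicalPhysics.QuantumLattice.dWaveFormFactor L)
                (Literature.MathematicalPhysics.QuantumLattice.pairField
                  Literature.MathematicalPhysics.QuantumLattice.dWaveFormFactor L)).re -
              (Matrix.gibbsState (Real.exp (a / U)) (Literature.MathematicalPhysics.QuantumLattice.dWaveSourceTorus L U μ h)
                (Literature.MathematicalPhysics.QuantumLattice.pairField
                  Literature.MathematicalPhysics.QuantumLattice.dWaveFormFactor L)).re ^ 2) -
            ((Matrix.duhamel (Real.exp (a / U)) (Literature.MathematicalPhysics.QuantumLattice.dWaveSourceTorus L 0 μ h)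
                (Literature.MathematicalPhysics.QuantumLattice.pairField
                  Literature.MathematicalPhysics.QuantumLattice.dWaveFormFactor L)
                (Literature.MathematicalPhysics.QuantumLattice.pairField
                  Literature.MathematicalPhysics.QuantumLattice.dWaveFormFactor L)).re -
              (Matrix.gibbsState (Real.exp (a / U)) (Literature.MathematicalPhysics.QuantumLattice.dWaveSourceTorus L 0 μ h)
                (Literature.MathematicalPhysics.QuantumLattice.pairField
                  Literature.MathematicalPhysics.QuantumLattice.dWaveFormFactor L)).re ^ 2) ≤
            C * a * (L : ℝ) ^ 2 / Real.exp (a / U)) →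
    TwSeededEnsembleEquivalenceR := fun hC hREM =>
  twR_of_condensation_of_fvDeepAnomalousSign hC (fam_fvDeepAnomalousSign_of_remainder hREM)

end Summit.HubbardSuperconductivity.HubbardSuperconductivity.Theorems
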